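import Literature.MathematicalPhysics.QuantumFieldTheory.Balaban1983to89.LatticeFieldCalculus

/-!
# `Balaban1983to89.B3TorusRadialSums` — lattice sums on the tori `T^{(j)}` of the series: the elementary estimates behind
*"we can estimate (3.16) by a constant"* (T. Bałaban, *(Higgs)₂,₃ quantum fields in a finite volume. III. Renormalization*,
Commun. Math. Phys. **88** (1983) 411–445 [Balaban1983Higgs3], p. 437) and behind every *"summation over x′ gives O(1)"* of
Sects. 2–3 of that paper

statement-level skeleton of published theorems with citation tags; proofs where landed; nothing here is a claim about the Yang–Mills mass gap

PDF held: `paper:balaban1983-higgs-2-3-quantum-fields-finite-volume` (journal page = PDF page + 410); p. 437 [PDF 27] read on the ×2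
render `run/shared/lean/pub/pub-balaban/b2b-balaban-ref1/pages/1983-cmp88-higgs23-III/1983-cmp88-higgs23-III-p027-x2.png`:
*"Using the inequalities |C^ξ(y − y′)| ≤ O(1)e^{−½|y−y′|}/|y − y′|, |G^ξ_{j″}(0; y, y′)| ≤ O(1)e^{−δ₀|y−y′|}/|y − y′|, and the corresponding
inequalities for derivatives, we can estimate (3.16) by a constant."*; p. 427 [PDF 17]: *"we use it [the exponential factor] to
make the summation over Δ(v′). We get some constant O(1) depending on δ₁ and n̄ only"*.

CITATION HEADER (lean-in-tree rule).  Part of the lit-balaban TYPED SKELETON (HOME `run/shared/lean/pub/lit-balaban/`), PHASE 2, seat p20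
generation 2.  This module is the GENERIC TOOLKIT of lattice sums on the carrier of record `…Balaban1983to89.Setup.Site P j = (ZMod n)^d`
(`n = P.sitesPerDir j`) with the two lattice distances of the cell: the `ℓ¹` distance `Site.tdist` and the `ℓ^∞` distance
`LatticeFieldCalculus.supDist` (both in lattice steps).  It asserts NOTHING of the paper: every statement is an elementary finite sum
estimate used without comment in print (rows B3.Eq3.11-3.17 ((3.16) "by a constant"), B3.Eq2.15-2.16 (p. 427 "summation over Δ(v′)")
of `HOME/lit-balaban-r15/ROWS-B3.md` cite it; the (3.16) bound itself is `B3Bound316`, same seat).  WHAT IS PROVED: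
* §1 the circular distance `cdist m = min(m.val, (−m).val)` on `ZMod n` and the counts `#{m : cdist m ≤ s} ≤ 2s + 1`,
  `#{m : cdist m = s} ≤ 2`; `tdist`/`supDist` in terms of `cdist`, `supDist ≤ tdist ≤ d·supDist`, `supDist y y′ = 0 ↔ y = y′`;
* §2 EXPONENTIAL SUMS by the product structure of the torus: `Σ_{y′} e^{−a|y−y′|₁} ≤ (2(1 + a⁻¹))^d` (`sum_exp_neg_tdist_le`), hence
  `Σ_{y′} e^{−a|y−y′|_∞} ≤ (2(1 + d/a))^d` — UNIFORM in the size of the torus;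
* §3 SHELL COUNTS in the sup norm: `#{y′ : |y − y′|_∞ = s} ≤ 2d(2s + 1)^{d−1}` for `s ≥ 1` (`card_shell_le`);
* §4 RADIAL SUMS WITH AN INTEGRABLE SINGULARITY: for `κ + p + 1 = d` (`κ ≤ d − 1`) and `a > 0`,
  `Σ_{y′ ≠ y} |y − y′|_∞^{−κ} e^{−a|y − y′|_∞} ≤ 2d·3^{d−1}·p!·(2/a)^p·(1 + 2/a)` (`radial_sum_le`) — the lattice version of
  `∫ d^dz |z|^{−κ}e^{−a|z|} < ∞`, uniform in the volume; with `a = cξ` and the Riemann weight `ξ^d(ξ|y−y′|)^{−κ}` this is bounded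
  uniformly in the lattice spacing `ξ ≤ 1` (`riemann_radial_sum_le`), which is what "estimate by a constant" on p. 437 uses.
Unit `lit-balaban-p20` (literature-prover-lit-balaban-p20-g2-0), 2026-08-21.
-/

open scoped BigOperators

namespace Literature.MathematicalPhysics.QuantumFieldTheory.Balaban1983to89.B3TorusRadialSums

open LatticeFieldCalculus

noncomputable section

/-! ## 1. The circular distance on `ZMod n`; `tdist` and `supDist` coordinatewise -/

section Cdist

variable {n : ℕ}

/-- The circular distance of a residue from `0`: `min(m.val, (−m).val)` lattice steps (the coordinatewise summand of `Site.tdist` and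
`LatticeFieldCalculus.supDist`). [folklore] -/
def cdist (m : ZMod n) : ℕ := min m.val (-m).val

/-- kernel: `cdist m ≤ m.val`. [cite: Balaban1982Higgs1, (1.3) p.604] -/
theorem cdist_le_val (m : ZMod n) : cdist m ≤ m.val := min_le_left _ _

/-- kernel: `cdist m ≤ (−m).val`. [cite: Balaban1982Higgs1, (1.3) p.604] -/
theorem cdist_le_neg_val (m : ZMod n) : cdist m ≤ (-m).val := min_le_right _ _

/-- kernel: `cdist (−m) = cdist m`. [cite: Balaban1982Higgs1, (1.3) p.604] -/
theorem cdist_neg (m : ZMod n) : cdist (-m) = cdist m := by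
  rw [cdist, cdist, neg_neg, min_comm]

/-- kernel: `cdist m = 0 ↔ m = 0`. [cite: Balaban1982Higgs1, (1.3) p.604] -/
theorem cdist_eq_zero_iff (m : ZMod n) : cdist m = 0 ↔ m = 0 := by
  constructor
  · intro h
    rcases Nat.min_eq_zero_iff.mp h with h1 | h1
    · exact (ZMod.val_eq_zero m).mp h1
    · have := (ZMod.val_eq_zero (-m)).mp h1; exact neg_eq_zero.mp this
  · rintro rfl; simp [cdist]

variable [NeZero n]

/-- kernel: a residue at circular distance `s` is `s` or `−s`. [cite: Balaban1982Higgs1, (1.3) p.604] -/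
theorem eq_or_eq_neg_of_cdist_eq (m : ZMod n) (s : ℕ) (h : cdist m = s) :
    m = (s : ZMod n) ∨ m = -(s : ZMod n) := by
  rcases min_choice m.val (-m).val with h1 | h1
  · left
    rw [cdist, h1] at h
    rw [← h, ZMod.natCast_zmod_val]
  · right
    rw [cdist, h1] at h
    rw [← h, ZMod.natCast_zmod_val, neg_neg]

/-- `#{m ∈ ZMod n : cdist m = s} ≤ 2`. [cite: Balaban1982Higgs1, (1.3) p.604] -/
theorem card_cdist_eq_le (s : ℕ) : (Finset.univ.filter fun m : ZMod n => cdist m = s).card ≤ 2 := by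
  classical
  calc (Finset.univ.filter fun m : ZMod n => cdist m = s).card
      ≤ ({(s : ZMod n), -(s : ZMod n)} : Finset (ZMod n)).card := by
        refine Finset.card_le_card fun m hm => ?_
        rw [Finset.mem_filter] at hm
        rcases eq_or_eq_neg_of_cdist_eq m s hm.2 with h | h <;> simp [h]
    _ ≤ 2 := Finset.card_le_two

/-- kernel: a residue at circular distance `≤ s` is the cast of an integer in `[−s, s]`. [cite: Balaban1982Higgs1, (1.3) p.604] -/
theorem exists_int_of_cdist_le (m : ZMod n) (s : ℕ) (h : cdist m ≤ s) :
    ∃ z : ℤ, z ∈ Finset.Icc (-(s : ℤ)) s ∧ (z : ZMod n) = m := by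
  rcases min_choice m.val (-m).val with h1 | h1
  · refine ⟨(m.val : ℤ), ?_, by rw [Int.cast_natCast, ZMod.natCast_zmod_val]⟩
    rw [cdist, h1] at h
    simp only [Finset.mem_Icc]; omega
  · refine ⟨-((-m).val : ℤ), ?_, by rw [Int.cast_neg, Int.cast_natCast, ZMod.natCast_zmod_val, neg_neg]⟩
    rw [cdist, h1] at h
    simp only [Finset.mem_Icc]; omega

/-- `#{m ∈ ZMod n : cdist m ≤ s} ≤ 2s + 1`. [cite: Balaban1982Higgs1, (1.3) p.604] -/
theorem card_cdist_le_le (s : ℕ) : (Finset.univ.filter fun m : ZMod n => cdist m ≤ s).card ≤ 2 * s + 1 := by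
  classical
  calc (Finset.univ.filter fun m : ZMod n => cdist m ≤ s).card
      ≤ ((Finset.Icc (-(s : ℤ)) s).image fun z : ℤ => (z : ZMod n)).card := by
        refine Finset.card_le_card fun m hm => ?_
        rw [Finset.mem_filter] at hm
        obtain ⟨z, hz, hzm⟩ := exists_int_of_cdist_le m s hm.2
        exact Finset.mem_image.mpr ⟨z, hz, hzm⟩
    _ ≤ (Finset.Icc (-(s : ℤ)) s).card := Finset.card_image_le
    _ = 2 * s + 1 := by rw [Int.card_Icc]; omega

end Cdist

section Distances

variable {P : Params} {j : ℕ}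

/-- The `ℓ¹` torus distance coordinatewise: `|x − y|₁ = Σ_μ cdist(x_μ − y_μ)`. [cite: Balaban1982Higgs1, (1.3) p.604] -/
theorem tdist_eq_sum_cdist (x y : Site P j) : Site.tdist x y = ∑ μ : Fin P.d, cdist (x μ - y μ) := by
  simp only [Site.tdist, cdist, neg_sub]

/-- The `ℓ^∞` torus distance coordinatewise: `|x − y|_∞ = max_μ cdist(x_μ − y_μ)`. [cite: Balaban1982Higgs1, (1.3) p.604] -/
theorem supDist_eq_sup_cdist (x y : Site P j) : supDist x y = Finset.univ.sup fun μ : Fin P.d => cdist (x μ - y μ) := by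
  simp only [supDist, cdist, neg_sub]

/-- Each coordinate is within the `ℓ^∞` distance. [cite: Balaban1982Higgs1, (1.3) p.604] -/
theorem cdist_le_supDist (x y : Site P j) (μ : Fin P.d) : cdist (x μ - y μ) ≤ supDist x y := by
  rw [supDist_eq_sup_cdist]
  exact Finset.le_sup (f := fun μ : Fin P.d => cdist (x μ - y μ)) (Finset.mem_univ μ)

/-- `|x − y|_∞ ≤ |x − y|₁`. [cite: Balaban1982Higgs1, (1.3) p.604] -/
theorem supDist_le_tdist (x y : Site P j) : supDist x y ≤ Site.tdist x y := by
  rw [supDist_eq_sup_cdist, tdist_eq_sum_cdist]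
  exact Finset.sup_le fun μ _ =>
    Finset.single_le_sum (f := fun μ : Fin P.d => cdist (x μ - y μ)) (fun _ _ => Nat.zero_le _) (Finset.mem_univ μ)

/-- `|x − y|₁ ≤ d·|x − y|_∞`. [cite: Balaban1982Higgs1, (1.3) p.604] -/
theorem tdist_le_mul_supDist (x y : Site P j) : Site.tdist x y ≤ P.d * supDist x y := by
  rw [tdist_eq_sum_cdist]
  calc ∑ μ : Fin P.d, cdist (x μ - y μ) ≤ ∑ _μ : Fin P.d, supDist x y :=
        Finset.sum_le_sum fun μ _ => cdist_le_supDist x y μ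
    _ = P.d * supDist x y := by rw [Finset.sum_const, Finset.card_univ, Fintype.card_fin, smul_eq_mul]

/-- `|x − y|_∞ = 0 ↔ x = y`. [cite: Balaban1982Higgs1, (1.3) p.604] -/
theorem supDist_eq_zero_iff (x y : Site P j) : supDist x y = 0 ↔ x = y := by
  constructor
  · intro h
    funext μ
    have h1 : cdist (x μ - y μ) = 0 := Nat.eq_zero_of_le_zero (h ▸ cdist_le_supDist x y μ)
    exact sub_eq_zero.mp ((cdist_eq_zero_iff _).mp h1)
  · rintro rfl
    simp [supDist_eq_sup_cdist, cdist]

/-- `|x − y|_∞` is symmetric. [cite: Balaban1982Higgs1, (1.3) p.604] -/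
theorem supDist_comm (x y : Site P j) : supDist x y = supDist y x := by
  simp only [supDist, min_comm]

end Distances

/-! ## 2. Exponential sums by the product structure of the torus -/

section ExpSums

/-- kernel: a finite geometric sum with ratio in `[0,1)` is at most `(1 − r)⁻¹`. [folklore] -/
private theorem geom_sum_le_inv {r : ℝ} (hr0 : 0 ≤ r) (hr1 : r < 1) (N : ℕ) :
    ∑ i ∈ Finset.range N, r ^ i ≤ (1 - r)⁻¹ := by
  have h1 : 0 < 1 - r := by linarith
  induction N with
  | zero => simp [inv_nonneg.mpr h1.le]
  | succ N ih =>
    rw [Finset.sum_range_succ', pow_zero]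
    have h2 : ∑ i ∈ Finset.range N, r ^ (i + 1) = r * ∑ i ∈ Finset.range N, r ^ i := by
      rw [Finset.mul_sum]; exact Finset.sum_congr rfl fun i _ => by ring
    rw [h2]
    have h3 : r * ∑ i ∈ Finset.range N, r ^ i ≤ r * (1 - r)⁻¹ := mul_le_mul_of_nonneg_left ih hr0
    have h4 : r * (1 - r)⁻¹ + 1 = (1 - r)⁻¹ := by field_simp; ring
    linarith

/-- kernel: `(1 − e^{−a})⁻¹ ≤ 1 + a⁻¹` for `a > 0` (from `1 + a ≤ e^a`). [folklore] -/
private theorem inv_one_sub_exp_neg_le {a : ℝ} (ha : 0 < a) : (1 - Real.exp (-a))⁻¹ ≤ 1 + a⁻¹ := by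
  have h1 : a + 1 ≤ Real.exp a := Real.add_one_le_exp a
  have h2 : Real.exp (-a) * Real.exp a = 1 := by rw [← Real.exp_add, neg_add_cancel, Real.exp_zero]
  have h3 : 0 < Real.exp (-a) := Real.exp_pos _
  have h4 : Real.exp (-a) < 1 := by rw [Real.exp_lt_one_iff]; linarith
  have h5 : 0 < 1 - Real.exp (-a) := by linarith
  rw [inv_le_comm₀ h5 (by positivity)]
  -- `(1 + a⁻¹)⁻¹ = a/(a+1) ≤ 1 − e^{−a}` ⟸ `(a+1)e^{−a} ≤ 1`
  have h6 : (1 + a⁻¹)⁻¹ = a / (a + 1) := by field_simp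
  rw [h6, div_le_iff₀ (by linarith)]
  nlinarith [mul_le_mul_of_nonneg_left h1 h3.le]

variable {n : ℕ} [NeZero n]

/-- kernel: `Σ_{m ∈ ZMod n} e^{−a·m.val} ≤ (1 − e^{−a})⁻¹`. [folklore] -/
private theorem sum_exp_neg_val_le {a : ℝ} (ha : 0 < a) :
    ∑ m : ZMod n, Real.exp (-(a * (m.val : ℝ))) ≤ (1 - Real.exp (-a))⁻¹ := by
  classical
  have hre : ∑ m : ZMod n, Real.exp (-(a * (m.val : ℝ))) = ∑ i ∈ Finset.range n, Real.exp (-a) ^ i := by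
    refine Finset.sum_nbij (fun m : ZMod n => m.val) (fun m _ => Finset.mem_range.mpr (ZMod.val_lt m)) ?_ ?_ ?_
    · intro m _ m' _ h; exact ZMod.val_injective n h
    · intro i hi
      have hi' : i < n := Finset.mem_range.mp (Finset.mem_coe.mp hi)
      exact ⟨(i : ZMod n), Finset.mem_coe.mpr (Finset.mem_univ _), ZMod.val_cast_of_lt hi'⟩
    · intro m _; rw [← Real.exp_nat_mul]; ring_nf
  rw [hre]
  exact geom_sum_le_inv (Real.exp_pos _).le (by rw [Real.exp_lt_one_iff]; linarith) n

/-- The one-dimensional circular exponential sum: `Σ_{m ∈ ZMod n} e^{−a·cdist m} ≤ 2(1 + a⁻¹)`, uniformly in `n`. [cite: Balaban1983Higgs3, (2.15) p.427] -/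
theorem sum_exp_neg_cdist_le {a : ℝ} (ha : 0 < a) :
    ∑ m : ZMod n, Real.exp (-(a * (cdist m : ℝ))) ≤ 2 * (1 + a⁻¹) := by
  have hpt : ∀ m : ZMod n, Real.exp (-(a * (cdist m : ℝ))) ≤
      Real.exp (-(a * (m.val : ℝ))) + Real.exp (-(a * ((-m).val : ℝ))) := by
    intro m
    rcases min_choice m.val (-m).val with h | h
    · rw [cdist, h]; linarith [Real.exp_pos (-(a * ((-m).val : ℝ)))]
    · rw [cdist, h]; linarith [Real.exp_pos (-(a * (m.val : ℝ)))]
  have hneg : ∑ m : ZMod n, Real.exp (-(a * ((-m).val : ℝ))) = ∑ m : ZMod n, Real.exp (-(a * (m.val : ℝ))) :=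
    Equiv.sum_comp (Equiv.neg (ZMod n)) (fun m => Real.exp (-(a * (m.val : ℝ))))
  calc ∑ m : ZMod n, Real.exp (-(a * (cdist m : ℝ)))
      ≤ ∑ m : ZMod n, (Real.exp (-(a * (m.val : ℝ))) + Real.exp (-(a * ((-m).val : ℝ)))) := Finset.sum_le_sum fun m _ => hpt m
    _ = 2 * ∑ m : ZMod n, Real.exp (-(a * (m.val : ℝ))) := by rw [Finset.sum_add_distrib, hneg, two_mul]
    _ ≤ 2 * (1 - Real.exp (-a))⁻¹ := by linarith [sum_exp_neg_val_le (n := n) ha]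
    _ ≤ 2 * (1 + a⁻¹) := by linarith [inv_one_sub_exp_neg_le ha]

/-- kernel: the product structure — a sum over `(ZMod n)^d` of a product of coordinate functions is the product of the coordinate
sums. [folklore] -/
private theorem sum_pi_prod_eq {d : ℕ} (f : Fin d → ZMod n → ℝ) :
    ∑ x : Fin d → ZMod n, ∏ μ : Fin d, f μ (x μ) = ∏ μ : Fin d, ∑ m : ZMod n, f μ m := by
  classical
  rw [Finset.prod_univ_sum, Fintype.piFinset_univ]

/-- kernel (generic form on `(ZMod n)^d`): `Σ_{x} e^{−a Σ_μ cdist(y_μ − x_μ)} ≤ (2(1 + a⁻¹))^d`. [folklore] -/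
private theorem sum_exp_neg_sum_cdist_le {d : ℕ} {a : ℝ} (ha : 0 < a) (y : Fin d → ZMod n) :
    ∑ x : Fin d → ZMod n, Real.exp (-(a * ((∑ μ : Fin d, cdist (y μ - x μ) : ℕ) : ℝ))) ≤ (2 * (1 + a⁻¹)) ^ d := by
  classical
  have hprod : ∀ x : Fin d → ZMod n, Real.exp (-(a * ((∑ μ : Fin d, cdist (y μ - x μ) : ℕ) : ℝ))) =
      ∏ μ : Fin d, Real.exp (-(a * (cdist (y μ - x μ) : ℝ))) := by
    intro x
    rw [← Real.exp_sum]
    congr 1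
    push_cast
    rw [Finset.mul_sum, ← Finset.sum_neg_distrib]
  simp_rw [hprod]
  rw [sum_pi_prod_eq (fun μ m => Real.exp (-(a * (cdist (y μ - m) : ℝ))))]
  have hcoord : ∀ μ : Fin d, ∑ m : ZMod n, Real.exp (-(a * (cdist (y μ - m) : ℝ))) ≤ 2 * (1 + a⁻¹) := by
    intro μ
    have h := Equiv.sum_comp (Equiv.subLeft (y μ)) (fun m : ZMod n => Real.exp (-(a * (cdist m : ℝ))))
    simp only [Equiv.subLeft_apply] at h
    rw [h]
    exact sum_exp_neg_cdist_le ha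
  calc ∏ μ : Fin d, ∑ m : ZMod n, Real.exp (-(a * (cdist (y μ - m) : ℝ)))
      ≤ ∏ _μ : Fin d, (2 * (1 + a⁻¹)) :=
        Finset.prod_le_prod (fun μ _ => Finset.sum_nonneg fun m _ => (Real.exp_pos _).le) fun μ _ => hcoord μ
    _ = (2 * (1 + a⁻¹)) ^ d := by rw [Finset.prod_const, Finset.card_univ, Fintype.card_fin]

variable {P : Params} {j : ℕ}

/-- **Exponential sums on the torus are uniformly bounded**: `Σ_{y′ ∈ T} e^{−a|y − y′|₁} ≤ (2(1 + a⁻¹))^d` for every `a > 0`, uniformly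
in the size of the torus (p. 427: *"we use it to make the summation over Δ(v′). We get some constant O(1) depending on δ₁ and n̄
only"*). [cite: Balaban1983Higgs3, (2.15) p.427] -/
theorem sum_exp_neg_tdist_le {a : ℝ} (ha : 0 < a) (y : Site P j) :
    ∑ y' : Site P j, Real.exp (-(a * (Site.tdist y y' : ℝ))) ≤ (2 * (1 + a⁻¹)) ^ P.d := by
  have h := sum_exp_neg_sum_cdist_le (n := P.sitesPerDir j) ha y
  simp only [← tdist_eq_sum_cdist] at h
  exact h

/-- The same with the sup norm: `Σ_{y′ ∈ T} e^{−a|y − y′|_∞} ≤ (2(1 + d/a))^d` (via `|·|₁ ≤ d|·|_∞`). [cite: Balaban1983Higgs3, (2.15) p.427] -/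
theorem sum_exp_neg_supDist_le {a : ℝ} (ha : 0 < a) (hd : 0 < P.d) (y : Site P j) :
    ∑ y' : Site P j, Real.exp (-(a * (supDist y y' : ℝ))) ≤ (2 * (1 + P.d / a)) ^ P.d := by
  have hd' : (0 : ℝ) < P.d := by exact_mod_cast hd
  have hpt : ∀ y' : Site P j, Real.exp (-(a * (supDist y y' : ℝ))) ≤ Real.exp (-(a / P.d * (Site.tdist y y' : ℝ))) := by
    intro y'
    rw [Real.exp_le_exp]
    have h1 : (Site.tdist y y' : ℝ) ≤ P.d * supDist y y' := by exact_mod_cast tdist_le_mul_supDist y y'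
    have h2 : a / P.d * (Site.tdist y y' : ℝ) ≤ a * supDist y y' := by
      calc a / P.d * (Site.tdist y y' : ℝ) ≤ a / P.d * (P.d * supDist y y') :=
            mul_le_mul_of_nonneg_left h1 (div_nonneg ha.le hd'.le)
        _ = a * supDist y y' := by field_simp
    linarith
  calc ∑ y' : Site P j, Real.exp (-(a * (supDist y y' : ℝ)))
      ≤ ∑ y' : Site P j, Real.exp (-(a / P.d * (Site.tdist y y' : ℝ))) := Finset.sum_le_sum fun y' _ => hpt y'
    _ ≤ (2 * (1 + (a / P.d)⁻¹)) ^ P.d := sum_exp_neg_tdist_le (div_pos ha hd') y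
    _ = (2 * (1 + P.d / a)) ^ P.d := by rw [inv_div]

end ExpSums

/-! ## 3. Shell counts in the sup norm -/

section Shells

variable {P : Params} {j : ℕ}

/-- The sup-norm shell of radius `s` around `y`. [folklore] -/
def shell (y : Site P j) (s : ℕ) : Finset (Site P j) := Finset.univ.filter fun y' => supDist y y' = s

/-- kernel: the coordinate conditions of the `μ`-th face of the sup-norm sphere: coordinate `μ` ON the sphere, the others in the
ball. [folklore] -/
private def faceCoord (y : Site P j) (s : ℕ) (μ ν : Fin P.d) : Finset (ZMod (P.sitesPerDir j)) :=
  Finset.univ.filter fun m : ZMod (P.sitesPerDir j) => if ν = μ then cdist (y ν - m) = s else cdist (y ν - m) ≤ s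

/-- kernel: the coordinate box with the `μ`-th coordinate ON the sphere: `{y′ : cdist(y_μ − y′_μ) = s, cdist(y_ν − y′_ν) ≤ s ∀ν}` as a
product finset. [folklore] -/
private def face (y : Site P j) (s : ℕ) (μ : Fin P.d) : Finset (Site P j) :=
  Fintype.piFinset (faceCoord y s μ)

/-- kernel: translating a coordinate condition does not increase the count. [folklore] -/
private theorem card_filter_sub_le {n : ℕ} [NeZero n] (c : ZMod n) (p : ZMod n → Prop) [DecidablePred p] :
    (Finset.univ.filter fun m : ZMod n => p (c - m)).card ≤ (Finset.univ.filter fun m : ZMod n => p m).card := by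
  calc (Finset.univ.filter fun m : ZMod n => p (c - m)).card
      ≤ ((Finset.univ.filter fun m : ZMod n => p m).image fun m => c - m).card := by
        refine Finset.card_le_card fun m hm => ?_
        rw [Finset.mem_filter] at hm
        exact Finset.mem_image.mpr ⟨c - m, Finset.mem_filter.mpr ⟨Finset.mem_univ _, hm.2⟩, sub_sub_cancel c m⟩
    _ ≤ _ := Finset.card_image_le

/-- kernel: `#face ≤ 2·(2s+1)^{d−1}`. [folklore] -/
private theorem card_face_le (y : Site P j) (s : ℕ) (μ : Fin P.d) : ((face y s μ).card : ℝ) ≤ 2 * (2 * s + 1) ^ (P.d - 1) := by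
  classical
  have hcard : (face y s μ).card = ∏ ν : Fin P.d, (faceCoord y s μ ν).card := Fintype.card_piFinset _
  have hμ : (faceCoord y s μ μ).card ≤ 2 := by
    have h1 : faceCoord y s μ μ = Finset.univ.filter fun m : ZMod (P.sitesPerDir j) => cdist (y μ - m) = s := by
      simp only [faceCoord, if_true]
    rw [h1]
    exact (card_filter_sub_le (y μ) (fun m => cdist m = s)).trans (card_cdist_eq_le s)
  have hν : ∀ ν ∈ Finset.univ.erase μ, (faceCoord y s μ ν).card ≤ 2 * s + 1 := by
    intro ν hν
    have hne : ν ≠ μ := Finset.ne_of_mem_erase hν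
    have h1 : faceCoord y s μ ν = Finset.univ.filter fun m : ZMod (P.sitesPerDir j) => cdist (y ν - m) ≤ s := by
      simp only [faceCoord, hne, if_false]
    rw [h1]
    exact (card_filter_sub_le (y ν) (fun m => cdist m ≤ s)).trans (card_cdist_le_le s)
  have hsplit : ∏ ν : Fin P.d, (faceCoord y s μ ν).card =
      (faceCoord y s μ μ).card * ∏ ν ∈ Finset.univ.erase μ, (faceCoord y s μ ν).card :=
    (Finset.mul_prod_erase Finset.univ (fun ν => (faceCoord y s μ ν).card) (Finset.mem_univ μ)).symm
  have hrest : ∏ ν ∈ Finset.univ.erase μ, (faceCoord y s μ ν).card ≤ (2 * s + 1) ^ (P.d - 1) := by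
    calc ∏ ν ∈ Finset.univ.erase μ, (faceCoord y s μ ν).card ≤ ∏ _ν ∈ Finset.univ.erase μ, (2 * s + 1) :=
          Finset.prod_le_prod (fun _ _ => Nat.zero_le _) hν
      _ = (2 * s + 1) ^ (P.d - 1) := by
          rw [Finset.prod_const, Finset.card_erase_of_mem (Finset.mem_univ μ), Finset.card_univ, Fintype.card_fin]
  have hnat : (face y s μ).card ≤ 2 * (2 * s + 1) ^ (P.d - 1) := by
    rw [hcard, hsplit]; exact Nat.mul_le_mul hμ hrest
  exact_mod_cast hnat

/-- **Shell count**: `#{y′ : |y − y′|_∞ = s} ≤ 2d(2s + 1)^{d−1}` for `s ≥ 1` (the lattice surface measure of the sup-norm sphere). [cite: Balaban1983Higgs3, (3.16) p.437] -/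
theorem card_shell_le (y : Site P j) {s : ℕ} (hs : 1 ≤ s) : ((shell y s).card : ℝ) ≤ 2 * P.d * (2 * s + 1) ^ (P.d - 1) := by
  classical
  have hsub : shell y s ⊆ Finset.univ.biUnion fun μ : Fin P.d => face y s μ := by
    intro y' hy'
    rw [shell, Finset.mem_filter] at hy'
    have hne : (Finset.univ : Finset (Fin P.d)).Nonempty := by
      by_contra h0
      rw [Finset.not_nonempty_iff_eq_empty] at h0
      have : supDist y y' = 0 := by rw [supDist_eq_sup_cdist, h0, Finset.sup_empty]; rfl
      omega
    obtain ⟨μ, -, hμ⟩ := Finset.exists_mem_eq_sup Finset.univ hne (fun ν : Fin P.d => cdist (y ν - y' ν))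
    rw [← supDist_eq_sup_cdist, hy'.2] at hμ
    refine Finset.mem_biUnion.mpr ⟨μ, Finset.mem_univ μ, ?_⟩
    refine Fintype.mem_piFinset.mpr fun ν => ?_
    unfold faceCoord
    refine Finset.mem_filter.mpr ⟨Finset.mem_univ _, ?_⟩
    by_cases h : ν = μ
    · subst h; rw [if_pos rfl]; exact hμ.symm
    · rw [if_neg h]; exact hy'.2 ▸ cdist_le_supDist y y' ν
  calc ((shell y s).card : ℝ) ≤ ((Finset.univ.biUnion fun μ : Fin P.d => face y s μ).card : ℝ) := by
        exact_mod_cast Finset.card_le_card hsub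
    _ ≤ ∑ μ : Fin P.d, ((face y s μ).card : ℝ) := by exact_mod_cast Finset.card_biUnion_le
    _ ≤ ∑ _μ : Fin P.d, (2 * (2 * s + 1) ^ (P.d - 1) : ℝ) := Finset.sum_le_sum fun μ _ => card_face_le y s μ
    _ = 2 * P.d * (2 * s + 1) ^ (P.d - 1) := by
        rw [Finset.sum_const, Finset.card_univ, Fintype.card_fin, nsmul_eq_mul]; ring

end Shells

/-! ## 4. Radial sums with an integrable singularity -/

section Radial

/-- kernel: `x^p e^{−bx} ≤ p!·b^{−p}` for `x ≥ 0`, `b > 0` (from `(bx)^p/p! ≤ e^{bx}`). [folklore] -/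
private theorem pow_mul_exp_neg_le {x b : ℝ} (hx : 0 ≤ x) (hb : 0 < b) (p : ℕ) :
    x ^ p * Real.exp (-(b * x)) ≤ p.factorial * b⁻¹ ^ p := by
  have h1 : (b * x) ^ p / p.factorial ≤ Real.exp (b * x) := Real.pow_div_factorial_le_exp _ (by positivity) p
  have h2 : Real.exp (b * x) * Real.exp (-(b * x)) = 1 := by rw [← Real.exp_add, add_neg_cancel, Real.exp_zero]
  have h3 : 0 < Real.exp (-(b * x)) := Real.exp_pos _
  have hfac : (0 : ℝ) < p.factorial := by exact_mod_cast Nat.factorial_pos p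
  have h4 : (b * x) ^ p * Real.exp (-(b * x)) ≤ p.factorial := by
    have := mul_le_mul_of_nonneg_right h1 h3.le
    rw [h2] at this
    rwa [div_mul_eq_mul_div, div_le_iff₀ hfac, one_mul] at this
  have hb' : b⁻¹ ^ p * (b * x) ^ p = x ^ p := by
    rw [← mul_pow, ← mul_assoc, inv_mul_cancel₀ hb.ne', one_mul]
  calc x ^ p * Real.exp (-(b * x)) = b⁻¹ ^ p * ((b * x) ^ p * Real.exp (-(b * x))) := by rw [← mul_assoc, hb']
    _ ≤ b⁻¹ ^ p * p.factorial := mul_le_mul_of_nonneg_left h4 (by positivity)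
    _ = p.factorial * b⁻¹ ^ p := mul_comm _ _

/-- The one-dimensional radial sum: `Σ_{s=1}^{S} (2s+1)^{q} s^{−κ}·e^{−as} ≤ 3^q · p! · (2/a)^p · (1 + 2/a)` whenever `q = κ + p`
(`(2s+1)^q ≤ 3^q s^q`, `s^{q−κ} = s^p`, half of the exponential against the power, half summed geometrically). [cite: Balaban1983Higgs3, (3.16) p.437] -/
theorem sum_shellWeight_le {a : ℝ} (ha : 0 < a) {q κ p : ℕ} (hqp : q = κ + p) (S : ℕ) :
    ∑ s ∈ Finset.Icc 1 S, ((2 * (s : ℝ) + 1) ^ q * ((s : ℝ) ^ κ)⁻¹ * Real.exp (-(a * s)))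
      ≤ 3 ^ q * (p.factorial * (2 / a) ^ p) * (1 + 2 / a) := by
  have hterm : ∀ s ∈ Finset.Icc 1 S, (2 * (s : ℝ) + 1) ^ q * ((s : ℝ) ^ κ)⁻¹ * Real.exp (-(a * s))
      ≤ 3 ^ q * (p.factorial * (2 / a) ^ p) * Real.exp (-(a / 2)) ^ s := by
    intro s hs
    have hs1 : (1 : ℝ) ≤ s := by exact_mod_cast (Finset.mem_Icc.mp hs).1
    have hs0 : (0 : ℝ) < s := by linarith
    -- `(2s+1)^q ≤ (3s)^q = 3^q s^κ s^p`
    have h1 : (2 * (s : ℝ) + 1) ^ q ≤ (3 : ℝ) ^ q * ((s : ℝ) ^ κ * (s : ℝ) ^ p) := by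
      rw [← pow_add, ← hqp, ← mul_pow]
      exact pow_le_pow_left₀ (by linarith) (by linarith) q
    -- half of the exponential against `s^p`
    have h2 : (s : ℝ) ^ p * Real.exp (-(a / 2 * s)) ≤ p.factorial * (2 / a) ^ p := by
      have := pow_mul_exp_neg_le hs0.le (half_pos ha) p
      rwa [show (a / 2)⁻¹ = 2 / a by rw [inv_div]] at this
    have hsplit : Real.exp (-(a * s)) = Real.exp (-(a / 2 * s)) * Real.exp (-(a / 2)) ^ s := by
      rw [← Real.exp_nat_mul, ← Real.exp_add]; ring_nf
    calc (2 * (s : ℝ) + 1) ^ q * ((s : ℝ) ^ κ)⁻¹ * Real.exp (-(a * s))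
        ≤ (3 : ℝ) ^ q * ((s : ℝ) ^ κ * (s : ℝ) ^ p) * ((s : ℝ) ^ κ)⁻¹ * Real.exp (-(a * s)) := by
          gcongr
      _ = (3 : ℝ) ^ q * ((s : ℝ) ^ p * Real.exp (-(a / 2 * s))) * Real.exp (-(a / 2)) ^ s := by
          rw [hsplit]; field_simp
      _ ≤ (3 : ℝ) ^ q * (p.factorial * (2 / a) ^ p) * Real.exp (-(a / 2)) ^ s := by
          gcongr
  have hgeom : ∑ s ∈ Finset.Icc 1 S, Real.exp (-(a / 2)) ^ s ≤ 1 + 2 / a := by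
    calc ∑ s ∈ Finset.Icc 1 S, Real.exp (-(a / 2)) ^ s ≤ ∑ s ∈ Finset.range (S + 1), Real.exp (-(a / 2)) ^ s := by
          refine Finset.sum_le_sum_of_subset_of_nonneg ?_ fun s _ _ => pow_nonneg (Real.exp_pos _).le s
          intro s hs
          rw [Finset.mem_Icc] at hs; rw [Finset.mem_range]; omega
      _ ≤ (1 - Real.exp (-(a / 2)))⁻¹ := geom_sum_le_inv (Real.exp_pos _).le (by rw [Real.exp_lt_one_iff]; linarith) _
      _ ≤ 1 + (a / 2)⁻¹ := inv_one_sub_exp_neg_le (half_pos ha)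
      _ = 1 + 2 / a := by rw [inv_div]
  calc ∑ s ∈ Finset.Icc 1 S, ((2 * (s : ℝ) + 1) ^ q * ((s : ℝ) ^ κ)⁻¹ * Real.exp (-(a * s)))
      ≤ ∑ s ∈ Finset.Icc 1 S, 3 ^ q * (p.factorial * (2 / a) ^ p) * Real.exp (-(a / 2)) ^ s := Finset.sum_le_sum hterm
    _ = 3 ^ q * (p.factorial * (2 / a) ^ p) * ∑ s ∈ Finset.Icc 1 S, Real.exp (-(a / 2)) ^ s := by rw [Finset.mul_sum]
    _ ≤ 3 ^ q * (p.factorial * (2 / a) ^ p) * (1 + 2 / a) := by gcongr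

variable {P : Params} {j : ℕ}

/-- kernel: a sum over `y′ ≠ y` of a function of the sup distance, shell by shell: `Σ_{y′≠y} F(|y−y′|_∞) = Σ_{s≥1} #shell_s · F(s)`
(all distances are `< n`, `n` the number of sites per direction). [folklore] -/
private theorem sum_ne_eq_sum_shell (y : Site P j) (F : ℕ → ℝ) :
    ∑ y' ∈ Finset.univ.filter (fun y' : Site P j => y' ≠ y), F (supDist y y')
      = ∑ s ∈ Finset.Icc 1 (P.sitesPerDir j), (shell y s).card * F s := by
  classical
  have hfib : ∀ y' ∈ Finset.univ.filter (fun y' : Site P j => y' ≠ y), supDist y y' ∈ Finset.Icc 1 (P.sitesPerDir j) := by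
    intro y' hy'
    rw [Finset.mem_filter] at hy'
    rw [Finset.mem_Icc]
    constructor
    · by_contra h0
      exact hy'.2 (((supDist_eq_zero_iff y y').mp (by omega)).symm)
    · rw [supDist_eq_sup_cdist]
      refine Finset.sup_le fun μ _ => (cdist_le_val _).trans (ZMod.val_le _)
  rw [← Finset.sum_fiberwise_of_maps_to hfib]
  refine Finset.sum_congr rfl fun s hs => ?_
  have hset : (Finset.univ.filter (fun y' : Site P j => y' ≠ y)).filter (fun y' => supDist y y' = s) = shell y s := by
    ext y'
    simp only [shell, Finset.mem_filter, Finset.mem_univ, true_and]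
    constructor
    · exact fun h => h.2
    · intro h
      refine ⟨fun h0 => ?_, h⟩
      have : supDist y y' = 0 := (supDist_eq_zero_iff y y').mpr h0.symm
      rw [Finset.mem_Icc] at hs; omega
  rw [hset]
  rw [Finset.sum_congr rfl (g := fun _ => F s) fun i hi => by
    simp only [shell, Finset.mem_filter, Finset.mem_univ, true_and] at hi; rw [hi]]
  rw [Finset.sum_const, nsmul_eq_mul]

/-- **RADIAL SUMS WITH AN INTEGRABLE SINGULARITY ARE UNIFORMLY BOUNDED** — the lattice version of `∫ d^dz |z|^{−κ} e^{−a|z|} < ∞`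
for `κ ≤ d − 1`: with `κ + p + 1 = d`, for every site `y` of the torus and every `a > 0`,
`Σ_{y′ ≠ y} |y − y′|_∞^{−κ} e^{−a|y − y′|_∞} ≤ 2d·3^{d−1}·p!·(2/a)^p·(1 + 2/a)`, uniformly in the size of the torus (shell count
`#{|y − y′|_∞ = s} ≤ 2d(2s+1)^{d−1}` times the one-dimensional `sum_shellWeight_le`).  This is the estimate behind p. 437, *"Using
the inequalities |C^ξ(y − y′)| ≤ O(1)e^{−½|y−y′|}/|y − y′|, … we can estimate (3.16) by a constant"*. [cite: Balaban1983Higgs3, (3.16) p.437] -/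
theorem radial_sum_le (y : Site P j) {a : ℝ} (ha : 0 < a) {κ p : ℕ} (hκp : κ + p + 1 = P.d) :
    ∑ y' ∈ Finset.univ.filter (fun y' : Site P j => y' ≠ y),
        ((supDist y y' : ℝ) ^ κ)⁻¹ * Real.exp (-(a * (supDist y y' : ℝ)))
      ≤ 2 * P.d * (3 ^ (P.d - 1) * (p.factorial * (2 / a) ^ p) * (1 + 2 / a)) := by
  classical
  rw [sum_ne_eq_sum_shell y (fun s => ((s : ℝ) ^ κ)⁻¹ * Real.exp (-(a * (s : ℝ))))]
  have hd1 : P.d - 1 = κ + p := by omega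
  calc ∑ s ∈ Finset.Icc 1 (P.sitesPerDir j), ((shell y s).card : ℝ) * (((s : ℝ) ^ κ)⁻¹ * Real.exp (-(a * (s : ℝ))))
      ≤ ∑ s ∈ Finset.Icc 1 (P.sitesPerDir j),
          (2 * P.d * (2 * (s : ℝ) + 1) ^ (P.d - 1)) * (((s : ℝ) ^ κ)⁻¹ * Real.exp (-(a * (s : ℝ)))) := by
        refine Finset.sum_le_sum fun s hs => mul_le_mul_of_nonneg_right ?_ (by positivity)
        have := card_shell_le y (Finset.mem_Icc.mp hs).1
        exact_mod_cast this
    _ = 2 * P.d * ∑ s ∈ Finset.Icc 1 (P.sitesPerDir j),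
          ((2 * (s : ℝ) + 1) ^ (P.d - 1) * ((s : ℝ) ^ κ)⁻¹ * Real.exp (-(a * s))) := by
        rw [Finset.mul_sum]
        exact Finset.sum_congr rfl fun s _ => by ring
    _ ≤ 2 * P.d * (3 ^ (P.d - 1) * (p.factorial * (2 / a) ^ p) * (1 + 2 / a)) := by
        refine mul_le_mul_of_nonneg_left (sum_shellWeight_le ha hd1 _) (by positivity)

/-- The RIEMANN-SUM form used on the `ξ`-lattice: with the weight `ξ^d` and the physical distance `ξ|y − y′|_∞`,
`Σ_{y′ ≠ y} ξ^d (ξ|y − y′|_∞)^{−κ} e^{−cξ|y − y′|_∞} ≤ 2d·3^{d−1}·p!·(2/c)^p·(ξ + 2/c)` (`κ + p + 1 = d`; substitute `a = cξ`):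
bounded uniformly in the lattice spacing `ξ ≤ 1` and in the volume — "estimate by a constant" (p. 437).
[cite: Balaban1983Higgs3, (3.16) p.437] -/
theorem riemann_radial_sum_le (y : Site P j) {c ξ : ℝ} (hc : 0 < c) (hξ : 0 < ξ) {κ p : ℕ} (hκp : κ + p + 1 = P.d) :
    ∑ y' ∈ Finset.univ.filter (fun y' : Site P j => y' ≠ y),
        ξ ^ P.d * (((ξ * supDist y y') ^ κ)⁻¹ * Real.exp (-(c * (ξ * supDist y y'))))
      ≤ 2 * P.d * (3 ^ (P.d - 1) * (p.factorial * (2 / c) ^ p) * (ξ + 2 / c)) := by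
  have hmain := radial_sum_le y (mul_pos hc hξ) hκp
  have hterm : ∀ y' : Site P j, ξ ^ P.d * (((ξ * supDist y y') ^ κ)⁻¹ * Real.exp (-(c * (ξ * supDist y y'))))
      = ξ ^ (p + 1) * (((supDist y y' : ℝ) ^ κ)⁻¹ * Real.exp (-(c * ξ * (supDist y y' : ℝ)))) := by
    intro y'
    rw [← hκp, mul_pow, mul_inv, show κ + p + 1 = κ + (p + 1) by ring, pow_add]
    have hξκ : (ξ ^ κ)⁻¹ * ξ ^ κ = 1 := inv_mul_cancel₀ (pow_ne_zero κ hξ.ne')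
    calc ξ ^ κ * ξ ^ (p + 1) * ((ξ ^ κ)⁻¹ * ((supDist y y' : ℝ) ^ κ)⁻¹ * Real.exp (-(c * (ξ * ↑(supDist y y')))))
        = ((ξ ^ κ)⁻¹ * ξ ^ κ) * (ξ ^ (p + 1) *
            (((supDist y y' : ℝ) ^ κ)⁻¹ * Real.exp (-(c * (ξ * ↑(supDist y y')))))) := by ring
      _ = _ := by rw [hξκ, one_mul, mul_assoc c]
  simp_rw [hterm]
  rw [← Finset.mul_sum]
  have hpow : ξ ^ (p + 1) * (2 * P.d * (3 ^ (P.d - 1) * (p.factorial * (2 / (c * ξ)) ^ p) * (1 + 2 / (c * ξ))))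
      = 2 * P.d * (3 ^ (P.d - 1) * (p.factorial * (2 / c) ^ p) * (ξ + 2 / c)) := by
    have h1 : (2 / (c * ξ)) ^ p = (2 / c) ^ p * (ξ ^ p)⁻¹ := by
      rw [div_mul_eq_div_div, div_pow, div_pow, ← div_eq_mul_inv, div_div, ← mul_pow, ← div_pow, mul_comm]
    have h2 : ξ * (1 + 2 / (c * ξ)) = ξ + 2 / c := by field_simp
    rw [h1, pow_succ]
    have h3 : ξ ^ p * (ξ ^ p)⁻¹ = 1 := mul_inv_cancel₀ (pow_ne_zero p hξ.ne')
    calc ξ ^ p * ξ * (2 * P.d * (3 ^ (P.d - 1) * (p.factorial * ((2 / c) ^ p * (ξ ^ p)⁻¹)) * (1 + 2 / (c * ξ))))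
        = (ξ ^ p * (ξ ^ p)⁻¹) * (2 * P.d * (3 ^ (P.d - 1) * (p.factorial * (2 / c) ^ p) * (ξ * (1 + 2 / (c * ξ))))) := by
          ring
      _ = _ := by rw [h3, one_mul, h2]
  calc ξ ^ (p + 1) * ∑ y' ∈ Finset.univ.filter (fun y' : Site P j => y' ≠ y),
          ((supDist y y' : ℝ) ^ κ)⁻¹ * Real.exp (-(c * ξ * (supDist y y' : ℝ)))
      ≤ ξ ^ (p + 1) * (2 * P.d * (3 ^ (P.d - 1) * (p.factorial * (2 / (c * ξ)) ^ p) * (1 + 2 / (c * ξ)))) :=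
        mul_le_mul_of_nonneg_left hmain (by positivity)
    _ = _ := hpow

end Radial

end

end Literature.MathematicalPhysics.QuantumFieldTheory.Balaban1983to89.B3TorusRadialSums
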